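import Summits.SmoothPoincare4.SmoothPoincare4.Theorems.EntropyRungBakryEmeryLogSobolevGaffneyCutoff
import HarnessLib

/-!
# The energy estimate of the weighted heat flow on a complete manifold with first-order
# (Gaffney) cut-offs (support item `EntropyRung.BakryEmeryLogSobolev`, stmt-SmoothPoincare4-16587)

Setting: `M` modelled on `ℝⁿ` (Hausdorff, second countable, `T₃`, Borel — NOT compact), `g`
Riemannian with its Levi-Civita connection, `V` smooth (NO further assumption on `V`),
`L = Δ_g − g⁻¹(dV, d·)`, weight `e^{-V} dV_g`, Gaffney cut-offs `η_k ∈ C_c^∞`, `0 ≤ η_k ≤ 1`,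
`η_k → 1` pointwise, `|∇η_k|² ≤ C₀/(k+1)²` (`EntropyRungBakryEmeryLogSobolevGaffneyCutoff.lean`).

* `integral_gradSq_cutoffSq_le` — the integrated energy inequality with ONE cut-off `η`:
  `∫∫_{M×(0,T)} η²|∇ρ|² e^{-V} ≤ E(0) − E(T) + 4 ∫∫_{M×(0,T)} (ρ − c)² |∇η|² e^{-V}`,
  `E(s) = ∫ (ρ(s) − c)² η² e^{-V}`, for a solution `∂ₛρ = Lρ` on `[0, T]` smooth on `M × O`
  (`O ⊇ [0,T]` open): `E' = 2∫(ρ−c)η²(Lρ)e^{-V} = −2∫η²|∇ρ|²e^{-V} − 4∫(ρ−c)η g⁻¹(dη,dρ)e^{-V}` and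
  `4|(ρ−c) η g⁻¹(dη,dρ)| ≤ η²|∇ρ|² + 4(ρ−c)²|∇η|²` (the first-order absorption);
* `gaffney_energyEstimate` — **with Gaffney cut-offs: if `(ρ − c)² e^{-V}` is integrable on the
  strip and at `s = 0`, then `|∇ρ|² e^{-V}` is integrable on the strip and
  `∫∫_{M×(0,T)} |∇ρ|² e^{-V} ≤ ∫ (ρ(0) − c)² e^{-V}`** (Fatou in `k`, the error being
  `≤ 4C₀/(k+1)² ∫∫(ρ − c)² e^{-V}`).

This is the `L²` ("finite energy") route of Bakry–Gentil–Ledoux (2014), §3.2, pp. 141–147, where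
every integration by parts on the complete manifold is justified with cut-offs `ζ_k` having only
`Γ(ζ_k) ≤ 1/k`. Everything is proved; no definitions, no named facts.

## References

* [BakryGentilLedoux2014] D. Bakry, I. Gentil, M. Ledoux, *Analysis and Geometry of Markov
  Diffusion Operators*, Springer 2014, §3.2 (pp. 141–147), Prop. 3.2.1, Thm. 3.2.6 (proofs).
* [Gaffney1954] M. P. Gaffney, Ann. of Math. 60 (1954) 140–145 (cut-offs on complete manifolds).
* [CarrilloNi2009] J. A. Carrillo, L. Ni, Comm. Anal. Geom. 17 (2009), §4.
-/

noncomputable section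

set_option linter.dupNamespace false

open scoped Manifold ContDiff ENNReal NNReal Topology
open MeasureTheory Set Filter
open Literature.Geometry.Lorentzian Literature.Geometry.Riemannian

namespace Summit.SmoothPoincare4.SmoothPoincare4.Theorems.BakryEmeryComplete

open NoncompactShrinkerGapHeat NoncompactShrinkerGapHeat.CutoffToolkit

section Energy

variable {n : ℕ} {M : Type*} [TopologicalSpace M] [T2Space M] [SecondCountableTopology M]
  [ChartedSpace (EuclideanSpace ℝ (Fin n)) M] [IsManifold (𝓡 n) ∞ M] [T3Space M]
  [MeasurableSpace M] [BorelSpace M]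
  {g : PseudoRiemannianMetric (𝓡 n) ∞ (EuclideanSpace ℝ (Fin n)) (TangentSpace (𝓡 n) : M → Type _)}
  [g.HasLeviCivita]

/-! ### The integrated energy inequality with one first-order cut-off -/

/-- **The integrated energy inequality with one cut-off, first-order version.** For `V` smooth,
`η ∈ C_c^∞`, `ρ` smooth on `M × O` (`O ⊇ [0, T]` open) with `∂ₛρ = Lρ` on `[0, T]`, and a constant `c`:
`∫∫_{M×(0,T)} η²|∇ρ|² e^{-V} ≤ E(0) − E(T) + 4 ∫∫_{M×(0,T)} (ρ − c)²|∇η|² e^{-V}`,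
`E(s) = ∫ (ρ(s) − c)² η² e^{-V}`: `E' = 2∫(ρ − c)η²(Lρ)e^{-V} = −2∫η²|∇ρ|²e^{-V} − 4∫(ρ−c)η g⁻¹(dη,dρ)e^{-V}
≤ −∫η²|∇ρ|²e^{-V} + 4∫(ρ−c)²|∇η|²e^{-V}` (Leibniz rule, `integral_mul_cutoffSq_mul_weightedLaplacian`,
`neg_four_mul_cutoff_innerDual_le`), integrated over `[0, T]` (FTC, Fubini). Only `|∇η|` enters —
no bound on `Lη` is used. [cite: BakryGentilLedoux2014, §3.2 (pp. 141–147)] -/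
theorem integral_gradSq_cutoffSq_le (hg : g.IsRiemannian) {V : M → ℝ}
    (hV : ContMDiff (𝓡 n) 𝓘(ℝ, ℝ) ∞ V) {η : M → ℝ} (hη : ContMDiff (𝓡 n) 𝓘(ℝ, ℝ) ∞ η)
    (hηc : HasCompactSupport η) {T : ℝ} {O : Set ℝ} {ρ : ℝ → M → ℝ} (hT : 0 < T) (hO : IsOpen O)
    (hTO : Icc 0 T ⊆ O)
    (hρ : ContMDiffOn ((𝓡 n).prod 𝓘(ℝ, ℝ)) 𝓘(ℝ, ℝ) ∞ (fun p : M × ℝ ↦ ρ p.2 p.1) (univ ×ˢ O))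
    (heq : ∀ s ∈ Icc 0 T, ∀ x, deriv (fun r ↦ ρ r x) s = g.dalembertian (ρ s) x
      - g.innerDual x (mvfderiv (𝓡 n) V x).toLinearMap (mvfderiv (𝓡 n) (ρ s) x).toLinearMap)
    (c : ℝ) :
    ∫ p, g.gradSq (ρ p.2) p.1 * (η p.1 ^ 2 * Real.exp (-V p.1))
        ∂(g.riemVolume.prod (volume : Measure ℝ)).restrict (univ ×ˢ Ioo 0 T) ≤
      ∫ x, (ρ 0 x - c) ^ 2 * (η x ^ 2 * Real.exp (-V x)) ∂g.riemVolume
        - ∫ x, (ρ T x - c) ^ 2 * (η x ^ 2 * Real.exp (-V x)) ∂g.riemVolume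
        + 4 * ∫ p, (ρ p.2 p.1 - c) ^ 2 * (g.gradSq η p.1 * Real.exp (-V p.1))
            ∂(g.riemVolume.prod (volume : Measure ℝ)).restrict (univ ×ˢ Ioo 0 T) := by
  haveI := CarrilloNi2009_shrinkerLSI.isFiniteMeasureOnCompacts_riemVolume hg
  haveI := sigmaFinite_riemVolume hg
  have h01 : (0 : ℝ) ≤ T := hT.le
  set μ : Measure M := g.riemVolume with hμ
  -- the two compactly supported weights `η² e^{-V}` and `|∇η|² e^{-V}`
  have hec : Continuous fun x ↦ Real.exp (-V x) := Real.continuous_exp.comp hV.continuous.neg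
  have hη2c : HasCompactSupport (fun x ↦ η x ^ 2) := by
    rw [show (fun x ↦ η x ^ 2) = fun x ↦ η x * η x from funext fun x ↦ sq (η x)]
    exact hηc.mul_right
  have hwE : Continuous fun x ↦ η x ^ 2 * Real.exp (-V x) := (hη.continuous.pow 2).mul hec
  have hwEc : HasCompactSupport fun x ↦ η x ^ 2 * Real.exp (-V x) := hη2c.mul_right
  have hgradη : Continuous (g.gradSq η) := (contMDiff_gradSq g hη).continuous
  have hgradηs : HasCompactSupport (g.gradSq η) :=
    HasCompactSupport.intro hηc fun x hx ↦ gradSq_eq_zero_of_notMem_tsupport hx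
  have hwY : Continuous fun x ↦ g.gradSq η x * Real.exp (-V x) := hgradη.mul hec
  have hwYc : HasCompactSupport fun x ↦ g.gradSq η x * Real.exp (-V x) := hgradηs.mul_right
  -- slices and time derivatives of `ρ`
  have hslice : ∀ s ∈ O, ContMDiff (𝓡 n) 𝓘(ℝ, ℝ) ∞ (ρ s) := fun s hs ↦
    contMDiff_slice_of_contMDiffOn hρ hs
  have hρc : ContinuousOn (fun p : M × ℝ ↦ ρ p.2 p.1) (univ ×ˢ O) := hρ.continuousOn
  have hρ'c : ContinuousOn (fun p : M × ℝ ↦ deriv (fun r ↦ ρ r p.1) p.2) (univ ×ˢ O) :=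
    continuousOn_deriv_time hO hρ
  have hF : ContinuousOn (fun p : M × ℝ ↦ (ρ p.2 p.1 - c) ^ 2) (univ ×ˢ O) :=
    (hρc.sub continuousOn_const).pow 2
  have hF' : ContinuousOn (fun p : M × ℝ ↦ 2 * (ρ p.2 p.1 - c) * deriv (fun r ↦ ρ r p.1) p.2)
      (univ ×ˢ O) := (continuousOn_const.mul (hρc.sub continuousOn_const)).mul hρ'c
  have hd : ∀ s ∈ O, ∀ x, HasDerivAt (fun r ↦ (ρ r x - c) ^ 2)
      (2 * (ρ s x - c) * deriv (fun r ↦ ρ r x) s) s := by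
    intro s hs x
    have h := ((hasDerivAt_time hO hρ x hs).sub_const c).pow 2
    refine h.congr_deriv ?_
    norm_num
  have hgradc : ContinuousOn (fun p : M × ℝ ↦ g.gradSq (ρ p.2) p.1) (univ ×ˢ O) :=
    (contMDiffOn_gradSq_family g hO.uniqueDiffOn hρ).continuousOn
  -- the energy `E`, its derivative `E'`, the gradient term `G` and the error term `Y`
  set E : ℝ → ℝ := fun s ↦ ∫ x, (ρ s x - c) ^ 2 * (η x ^ 2 * Real.exp (-V x)) ∂μ with hE
  set E' : ℝ → ℝ := fun s ↦
    ∫ x, (2 * (ρ s x - c) * deriv (fun r ↦ ρ r x) s) * (η x ^ 2 * Real.exp (-V x)) ∂μ with hE'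
  set G : ℝ → ℝ := fun s ↦ ∫ x, g.gradSq (ρ s) x * (η x ^ 2 * Real.exp (-V x)) ∂μ with hG
  set Y : ℝ → ℝ := fun s ↦ ∫ x, (ρ s x - c) ^ 2 * (g.gradSq η x * Real.exp (-V x)) ∂μ with hY
  have hEd : ∀ s ∈ O, HasDerivAt E (E' s) s := fun s hs ↦
    hasDerivAt_integral_mul_of_hasCompactSupport μ hwE hwEc hO hF hF' hd hs
  have hE'c : ContinuousOn E' O := continuousOn_integral_mul_of_hasCompactSupport μ hwE hwEc hF'
  have hGc : ContinuousOn G O := continuousOn_integral_mul_of_hasCompactSupport μ hwE hwEc hgradc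
  have hYc : ContinuousOn Y O := continuousOn_integral_mul_of_hasCompactSupport μ hwY hwYc hF
  -- `E' ≤ -G + 4 Y` on `[0, T]`
  have hE'le : ∀ s ∈ Icc 0 T, E' s ≤ -G s + 4 * Y s := by
    intro s hs
    have hsO := hTO hs
    have hρs := hslice s hsO
    have hid := integral_mul_cutoffSq_mul_weightedLaplacian hg (a := fun y ↦ ρ s y - c)
      (hρs.sub contMDiff_const) hρs hη hηc hV
    -- `E' s = 2 ∫ (ρ - c) η² (Lρ) e^{-V}`
    have e0 : E' s = 2 * ∫ x, (ρ s x - c) * η x ^ 2 * (g.dalembertian (ρ s) x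
        - g.innerDual x (mvfderiv (𝓡 n) V x).toLinearMap (mvfderiv (𝓡 n) (ρ s) x).toLinearMap) *
          Real.exp (-V x) ∂μ := by
      rw [hE', ← integral_const_mul]
      refine integral_congr_ae (Eventually.of_forall fun x ↦ ?_)
      simp only [heq s hs x]
      ring
    -- `d(ρ - c) = dρ`, so the first Green term is `G s`
    have hdsub : ∀ x, (mvfderiv (𝓡 n) (fun y ↦ ρ s y - c) x).toLinearMap =
        (mvfderiv (𝓡 n) (ρ s) x).toLinearMap := fun x ↦ by
      rw [mvfderiv_fun_sub (hρs.mdifferentiableAt (by simp)) mdifferentiableAt_const, mvfderiv_const,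
        sub_zero]
    have e1 : ∫ x, η x ^ 2 * g.innerDual x (mvfderiv (𝓡 n) (fun y ↦ ρ s y - c) x).toLinearMap
        (mvfderiv (𝓡 n) (ρ s) x).toLinearMap * Real.exp (-V x) ∂μ = G s := by
      refine integral_congr_ae (Eventually.of_forall fun x ↦ ?_)
      simp only [hdsub x]
      rw [show g.innerDual x (mvfderiv (𝓡 n) (ρ s) x).toLinearMap (mvfderiv (𝓡 n) (ρ s) x).toLinearMap
        = g.gradSq (ρ s) x from rfl]
      ring
    -- the cross term is absorbed: `-4 X ≤ G + 4 Y`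
    set X : ℝ := ∫ x, (ρ s x - c) * η x * g.innerDual x (mvfderiv (𝓡 n) η x).toLinearMap
        (mvfderiv (𝓡 n) (ρ s) x).toLinearMap * Real.exp (-V x) ∂μ with hX
    have h1' : (1 : ℕ∞ω) ≤ (∞ : ℕ∞ω) := WithTop.coe_le_coe.mpr le_top
    have hIc : Continuous fun x ↦ g.innerDual x (mvfderiv (𝓡 n) η x).toLinearMap
        (mvfderiv (𝓡 n) (ρ s) x).toLinearMap :=
      continuous_innerDual_mvfderiv g (hη.of_le h1') (hρs.of_le h1')
    have iX : Integrable (fun x ↦ -(4 * ((ρ s x - c) * η x * g.innerDual x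
        (mvfderiv (𝓡 n) η x).toLinearMap (mvfderiv (𝓡 n) (ρ s) x).toLinearMap)) * Real.exp (-V x)) μ := by
      refine integrable_of_continuous_of_hasCompactSupport' hg
        ((continuous_const.mul (((hρs.continuous.sub continuous_const).mul hη.continuous).mul
          hIc)).neg.mul hec) ?_
      exact ((((hηc.mul_left).mul_right).mul_left).neg).mul_right
    have iGY : Integrable (fun x ↦ (η x ^ 2 * g.gradSq (ρ s) x + 4 * ((ρ s x - c) ^ 2 * g.gradSq η x))
        * Real.exp (-V x)) μ := by
      refine integrable_of_continuous_of_hasCompactSupport' hg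
        ((((hη.continuous.pow 2).mul (contMDiff_gradSq g hρs).continuous).add
          (continuous_const.mul ((hρs.continuous.sub continuous_const).pow 2 |>.mul hgradη))).mul hec) ?_
      refine HasCompactSupport.mul_right ?_
      exact (hη2c.mul_right).add ((hgradηs.mul_left).mul_left)
    have hmono := integral_mono iX iGY fun x ↦
      mul_le_mul_of_nonneg_right (neg_four_mul_cutoff_innerDual_le hg (ρ s) η c x) (Real.exp_nonneg _)
    have eX : ∫ x, -(4 * ((ρ s x - c) * η x * g.innerDual x (mvfderiv (𝓡 n) η x).toLinearMap
        (mvfderiv (𝓡 n) (ρ s) x).toLinearMap)) * Real.exp (-V x) ∂μ = -4 * X := by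
      rw [hX, ← integral_const_mul]
      exact integral_congr_ae (Eventually.of_forall fun x ↦ by ring)
    have iG1 : Integrable (fun x ↦ η x ^ 2 * g.gradSq (ρ s) x * Real.exp (-V x)) μ :=
      integrable_of_continuous_of_hasCompactSupport' hg
        (((hη.continuous.pow 2).mul (contMDiff_gradSq g hρs).continuous).mul hec)
        (hη2c.mul_right.mul_right)
    have iY1 : Integrable (fun x ↦ 4 * ((ρ s x - c) ^ 2 * g.gradSq η x) * Real.exp (-V x)) μ :=
      integrable_of_continuous_of_hasCompactSupport' hg
        ((continuous_const.mul (((hρs.continuous.sub continuous_const).pow 2).mul hgradη)).mul hec)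
        (((hgradηs.mul_left).mul_left).mul_right)
    have eGY : ∫ x, (η x ^ 2 * g.gradSq (ρ s) x + 4 * ((ρ s x - c) ^ 2 * g.gradSq η x))
        * Real.exp (-V x) ∂μ = G s + 4 * Y s := by
      have e2 : ∫ x, (η x ^ 2 * g.gradSq (ρ s) x + 4 * ((ρ s x - c) ^ 2 * g.gradSq η x))
          * Real.exp (-V x) ∂μ = ∫ x, (η x ^ 2 * g.gradSq (ρ s) x * Real.exp (-V x)
            + 4 * ((ρ s x - c) ^ 2 * g.gradSq η x) * Real.exp (-V x)) ∂μ :=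
        integral_congr_ae (Eventually.of_forall fun x ↦ by ring)
      rw [e2, integral_add iG1 iY1]
      have e3 : ∫ x, η x ^ 2 * g.gradSq (ρ s) x * Real.exp (-V x) ∂μ = G s :=
        integral_congr_ae (Eventually.of_forall fun x ↦ by ring)
      have e4 : ∫ x, 4 * ((ρ s x - c) ^ 2 * g.gradSq η x) * Real.exp (-V x) ∂μ = 4 * Y s := by
        rw [hY, ← integral_const_mul]
        exact integral_congr_ae (Eventually.of_forall fun x ↦ by ring)
      rw [e3, e4]
    rw [eX, eGY] at hmono
    rw [e0, hid, e1]
    linarith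
  -- the fundamental theorem of calculus on `[0, T]` and monotonicity of the integral
  have huIcc : uIcc (0 : ℝ) T = Icc 0 T := uIcc_of_le h01
  have hFTC : ∫ s in (0 : ℝ)..T, E' s = E T - E 0 :=
    intervalIntegral.integral_eq_sub_of_hasDerivAt (fun s hs ↦ hEd s (hTO (huIcc ▸ hs)))
      ((hE'c.mono hTO).intervalIntegrable_of_Icc h01)
  have hGi : IntervalIntegrable G volume 0 T := (hGc.mono hTO).intervalIntegrable_of_Icc h01
  have hYi : IntervalIntegrable Y volume 0 T := (hYc.mono hTO).intervalIntegrable_of_Icc h01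
  have hE'i : IntervalIntegrable E' volume 0 T := (hE'c.mono hTO).intervalIntegrable_of_Icc h01
  have hGi' : IntervalIntegrable (fun s ↦ -G s) volume 0 T := hGi.neg
  have hYi' : IntervalIntegrable (fun s ↦ 4 * Y s) volume 0 T := hYi.const_mul 4
  have hmonoI : ∫ s in (0 : ℝ)..T, E' s ≤ ∫ s in (0 : ℝ)..T, (-G s + 4 * Y s) :=
    intervalIntegral.integral_mono_on h01 hE'i (hGi'.add hYi') fun s hs ↦ hE'le s hs
  have hsplit : ∫ s in (0 : ℝ)..T, (-G s + 4 * Y s) =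
      -(∫ s in (0 : ℝ)..T, G s) + 4 * ∫ s in (0 : ℝ)..T, Y s := by
    rw [intervalIntegral.integral_add hGi' hYi', intervalIntegral.integral_neg,
      intervalIntegral.integral_const_mul]
  -- Fubini on the strip for `G` and `Y`
  have hGF : ∫ p, g.gradSq (ρ p.2) p.1 * (η p.1 ^ 2 * Real.exp (-V p.1))
      ∂(μ.prod (volume : Measure ℝ)).restrict (univ ×ˢ Ioo 0 T) = ∫ s in (0 : ℝ)..T, G s :=
    integral_strip_eq_intervalIntegral μ h01
      (integrable_strip_mul_of_hasCompactSupport μ (hgradc.mono (prod_mono le_rfl hTO)) hwE hwEc)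
  have hYF : ∫ p, (ρ p.2 p.1 - c) ^ 2 * (g.gradSq η p.1 * Real.exp (-V p.1))
      ∂(μ.prod (volume : Measure ℝ)).restrict (univ ×ˢ Ioo 0 T) = ∫ s in (0 : ℝ)..T, Y s :=
    integral_strip_eq_intervalIntegral μ h01
      (integrable_strip_mul_of_hasCompactSupport μ (hF.mono (prod_mono le_rfl hTO)) hwY hwYc)
  have eE0 : E 0 = ∫ x, (ρ 0 x - c) ^ 2 * (η x ^ 2 * Real.exp (-V x)) ∂μ := rfl
  have eET : E T = ∫ x, (ρ T x - c) ^ 2 * (η x ^ 2 * Real.exp (-V x)) ∂μ := rfl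
  rw [hGF, hYF]
  linarith [hFTC, hsplit, hmonoI, eE0, eET]

/-! ### The energy estimate with Gaffney cut-offs -/

/-- **The energy estimate for the weighted heat flow on a complete manifold, with Gaffney
cut-offs.** `V` smooth (no other assumption), `η_k ∈ C_c^∞`, `0 ≤ η_k ≤ 1`, `η_k → 1` pointwise,
`|∇η_k|² ≤ C₀/(k+1)²`; `ρ` smooth on `M × O` (`O ⊇ [0, T]` open) with `∂ₛρ = Lρ` on `[0, T]`,
`(ρ − c)² e^{-V}` integrable on the strip `M × (0, T)` and at `s = 0`. Then `|∇ρ|² e^{-V}` is integrable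
on the strip and `∫∫_{M×(0,T)} |∇ρ|² e^{-V} ≤ ∫ (ρ(0) − c)² e^{-V}`. Proof: `integral_gradSq_cutoffSq_le`
with `η = η_k`: `∫∫ η_k²|∇ρ|²e^{-V} ≤ ∫(ρ₀ − c)²e^{-V} + 4C₀/(k+1)² ∫∫(ρ − c)²e^{-V}`; Fatou (`η_k² → 1`)
and dominated convergence. This is the finite-energy property of `𝕃²` solutions, BGL §3.2.
[cite: BakryGentilLedoux2014, §3.2 (pp. 141–147)] -/
theorem gaffney_energyEstimate (hg : g.IsRiemannian) {V : M → ℝ} (hV : ContMDiff (𝓡 n) 𝓘(ℝ, ℝ) ∞ V)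
    {η : ℕ → M → ℝ} {C₀ : ℝ} (hηs : ∀ k, ContMDiff (𝓡 n) 𝓘(ℝ, ℝ) ∞ (η k))
    (hηc : ∀ k, HasCompactSupport (η k)) (hη01 : ∀ k x, 0 ≤ η k x ∧ η k x ≤ 1)
    (hη1 : ∀ x, ∀ᶠ k in atTop, η k x = 1)
    (hηgrad : ∀ k x, g.gradSq (η k) x ≤ C₀ / ((k : ℝ) + 1) ^ 2)
    {T : ℝ} {O : Set ℝ} {ρ : ℝ → M → ℝ} (hT : 0 < T) (hO : IsOpen O) (hTO : Icc 0 T ⊆ O)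
    (hρ : ContMDiffOn ((𝓡 n).prod 𝓘(ℝ, ℝ)) 𝓘(ℝ, ℝ) ∞ (fun p : M × ℝ ↦ ρ p.2 p.1) (univ ×ˢ O))
    (heq : ∀ s ∈ Icc 0 T, ∀ x, deriv (fun r ↦ ρ r x) s = g.dalembertian (ρ s) x
      - g.innerDual x (mvfderiv (𝓡 n) V x).toLinearMap (mvfderiv (𝓡 n) (ρ s) x).toLinearMap)
    (c : ℝ)
    (hInt : Integrable (fun p : M × ℝ ↦ (ρ p.2 p.1 - c) ^ 2 * Real.exp (-V p.1))
      ((g.riemVolume.prod (volume : Measure ℝ)).restrict (univ ×ˢ Ioo 0 T)))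
    (h0 : Integrable (fun x ↦ (ρ 0 x - c) ^ 2 * Real.exp (-V x)) g.riemVolume) :
    Integrable (fun p : M × ℝ ↦ g.gradSq (ρ p.2) p.1 * Real.exp (-V p.1))
        ((g.riemVolume.prod (volume : Measure ℝ)).restrict (univ ×ˢ Ioo 0 T)) ∧
      ∫ p in univ ×ˢ Ioo 0 T, g.gradSq (ρ p.2) p.1 * Real.exp (-V p.1)
          ∂(g.riemVolume.prod (volume : Measure ℝ)) ≤
        ∫ x, (ρ 0 x - c) ^ 2 * Real.exp (-V x) ∂g.riemVolume := by
  haveI := CarrilloNi2009_shrinkerLSI.isFiniteMeasureOnCompacts_riemVolume hg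
  haveI := sigmaFinite_riemVolume hg
  set μ : Measure M := g.riemVolume with hμ
  set ν : Measure (M × ℝ) := (μ.prod (volume : Measure ℝ)).restrict (univ ×ˢ Ioo 0 T) with hν
  set A : ℝ := ∫ x, (ρ 0 x - c) ^ 2 * Real.exp (-V x) ∂μ with hA
  set B : ℝ := ∫ p, (ρ p.2 p.1 - c) ^ 2 * Real.exp (-V p.1) ∂ν with hB
  set r : ℕ → ℝ := fun k ↦ ∫ p, (ρ p.2 p.1 - c) ^ 2 * (g.gradSq (η k) p.1 * Real.exp (-V p.1)) ∂ν
    with hr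
  set F : M × ℝ → ℝ := fun p ↦ g.gradSq (ρ p.2) p.1 * Real.exp (-V p.1) with hFdef
  have hec : Continuous fun x ↦ Real.exp (-V x) := Real.continuous_exp.comp hV.continuous.neg
  have hεpos : ∀ k : ℕ, (0 : ℝ) < ((k : ℝ) + 1) ^ 2 := fun k ↦ by positivity
  -- Step 1: the integrated inequality for every `k`
  have hid : ∀ k, ∫ p, g.gradSq (ρ p.2) p.1 * (η k p.1 ^ 2 * Real.exp (-V p.1)) ∂ν ≤
      ∫ x, (ρ 0 x - c) ^ 2 * (η k x ^ 2 * Real.exp (-V x)) ∂μ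
        - ∫ x, (ρ T x - c) ^ 2 * (η k x ^ 2 * Real.exp (-V x)) ∂μ + 4 * r k := fun k ↦
    integral_gradSq_cutoffSq_le hg hV (hηs k) (hηc k) hT hO hTO hρ heq c
  -- Step 2: `E_k(0) ≤ A`, `E_k(T) ≥ 0`
  have hsq1 : ∀ k x, η k x ^ 2 ≤ 1 := fun k x ↦ pow_le_one₀ (hη01 k x).1 (hη01 k x).2
  have hE0 : ∀ k, ∫ x, (ρ 0 x - c) ^ 2 * (η k x ^ 2 * Real.exp (-V x)) ∂μ ≤ A := fun k ↦ by
    refine integral_mono_of_nonneg (Eventually.of_forall fun x ↦ ?_) h0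
      (Eventually.of_forall fun x ↦ ?_)
    · exact mul_nonneg (sq_nonneg _) (mul_nonneg (sq_nonneg _) (Real.exp_nonneg _))
    · exact mul_le_mul_of_nonneg_left (mul_le_of_le_one_left (Real.exp_nonneg _) (hsq1 k x))
        (sq_nonneg _)
  have hET : ∀ k, 0 ≤ ∫ x, (ρ T x - c) ^ 2 * (η k x ^ 2 * Real.exp (-V x)) ∂μ := fun k ↦
    integral_nonneg fun x ↦ mul_nonneg (sq_nonneg _) (mul_nonneg (sq_nonneg _) (Real.exp_nonneg _))
  -- Step 3: the error terms `r k ≤ C₀/(k+1)² B` tend to `0`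
  have hcontρ : ContinuousOn (fun p : M × ℝ ↦ ρ p.2 p.1) (univ ×ˢ Ioo 0 T) :=
    hρ.continuousOn.mono (prod_mono le_rfl (Ioo_subset_Icc_self.trans hTO))
  have hgradηc : ∀ k, Continuous (g.gradSq (η k)) := fun k ↦ (contMDiff_gradSq g (hηs k)).continuous
  have hr_meas : ∀ k, AEStronglyMeasurable
      (fun p : M × ℝ ↦ (ρ p.2 p.1 - c) ^ 2 * (g.gradSq (η k) p.1 * Real.exp (-V p.1))) ν := fun k ↦
    aestronglyMeasurable_strip μ (((hcontρ.sub continuousOn_const).pow 2).mul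
      (((hgradηc k).comp continuous_fst).mul (hec.comp continuous_fst)).continuousOn)
  have hr_bound : ∀ k (p : M × ℝ), ‖(ρ p.2 p.1 - c) ^ 2 * (g.gradSq (η k) p.1 * Real.exp (-V p.1))‖ ≤
      C₀ / ((k : ℝ) + 1) ^ 2 * ((ρ p.2 p.1 - c) ^ 2 * Real.exp (-V p.1)) := fun k p ↦ by
    rw [Real.norm_eq_abs, abs_of_nonneg (mul_nonneg (sq_nonneg _)
      (mul_nonneg (g.gradSq_nonneg hg _ _) (Real.exp_nonneg _)))]
    have h0' : 0 ≤ (ρ p.2 p.1 - c) ^ 2 * Real.exp (-V p.1) := mul_nonneg (sq_nonneg _) (Real.exp_nonneg _)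
    calc (ρ p.2 p.1 - c) ^ 2 * (g.gradSq (η k) p.1 * Real.exp (-V p.1))
        = g.gradSq (η k) p.1 * ((ρ p.2 p.1 - c) ^ 2 * Real.exp (-V p.1)) := by ring
      _ ≤ C₀ / ((k : ℝ) + 1) ^ 2 * ((ρ p.2 p.1 - c) ^ 2 * Real.exp (-V p.1)) :=
          mul_le_mul_of_nonneg_right (hηgrad k p.1) h0'
  have hB0 : 0 ≤ B := integral_nonneg fun p ↦ mul_nonneg (sq_nonneg _) (Real.exp_nonneg _)
  have hr_le : ∀ k, r k ≤ C₀ / ((k : ℝ) + 1) ^ 2 * B := fun k ↦ by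
    calc r k ≤ ‖r k‖ := Real.le_norm_self _
      _ ≤ ∫ p, ‖(ρ p.2 p.1 - c) ^ 2 * (g.gradSq (η k) p.1 * Real.exp (-V p.1))‖ ∂ν :=
          norm_integral_le_integral_norm _
      _ ≤ ∫ p, C₀ / ((k : ℝ) + 1) ^ 2 * ((ρ p.2 p.1 - c) ^ 2 * Real.exp (-V p.1)) ∂ν :=
          integral_mono_of_nonneg (Eventually.of_forall fun p ↦ norm_nonneg _) (hInt.const_mul _)
            (Eventually.of_forall (hr_bound k))
      _ = C₀ / ((k : ℝ) + 1) ^ 2 * B := integral_const_mul _ _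
  -- `C₀ ≥ 0` unless `M` is empty, in which case `B = 0`; either way `C₀ B ≥ 0`-type bounds hold
  have hC₀B : ∀ k : ℕ, C₀ / ((k : ℝ) + 1) ^ 2 * B ≤ |C₀| * B := fun k ↦ by
    refine mul_le_mul_of_nonneg_right ?_ hB0
    refine (le_abs_self _).trans ?_
    rw [abs_div, abs_of_pos (hεpos k)]
    refine div_le_self (abs_nonneg _) ?_
    have : (1 : ℝ) ≤ (k : ℝ) + 1 := by linarith [(Nat.cast_nonneg k : (0 : ℝ) ≤ k)]
    exact one_le_pow₀ this
  have hr_tendsto : Tendsto (fun k : ℕ ↦ C₀ / ((k : ℝ) + 1) ^ 2 * B) atTop (𝓝 0) := by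
    have h1 : Tendsto (fun k : ℕ ↦ ((k : ℝ) + 1) ^ 2) atTop atTop :=
      (tendsto_pow_atTop two_ne_zero).comp
        (tendsto_atTop_add_const_right _ 1 (tendsto_natCast_atTop_atTop (R := ℝ)))
    have h2 : Tendsto (fun k : ℕ ↦ C₀ / ((k : ℝ) + 1) ^ 2) atTop (𝓝 0) :=
      tendsto_const_nhds.div_atTop h1
    simpa using h2.mul_const B
  -- Step 4: `∫ η_k² F ≤ A + 4 r_k ≤ A + 4 C₀ B`
  have hI_le : ∀ k, ∫ p, η k p.1 ^ 2 * F p ∂ν ≤ A + 4 * (C₀ / ((k : ℝ) + 1) ^ 2 * B) := fun k ↦ by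
    have e : ∫ p, η k p.1 ^ 2 * F p ∂ν = ∫ p, g.gradSq (ρ p.2) p.1 * (η k p.1 ^ 2 * Real.exp (-V p.1)) ∂ν :=
      integral_congr_ae (Eventually.of_forall fun p ↦ by simp only [hFdef]; ring)
    rw [e]
    linarith [hid k, hE0 k, hET k, hr_le k]
  have hKbound : ∀ k, ∫ p, η k p.1 ^ 2 * F p ∂ν ≤ A + 4 * (|C₀| * B) := fun k ↦ by
    linarith [hI_le k, hC₀B k]
  -- Step 5: Fatou gives the integrability of `F = |∇ρ|² e^{-V}` on the strip
  have hgradc : ContinuousOn (fun p : M × ℝ ↦ g.gradSq (ρ p.2) p.1) (univ ×ˢ O) :=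
    (contMDiffOn_gradSq_family g hO.uniqueDiffOn hρ).continuousOn
  have hFm : AEStronglyMeasurable F ν :=
    aestronglyMeasurable_strip μ ((hgradc.mono (prod_mono le_rfl (Ioo_subset_Icc_self.trans hTO))).mul
      (hec.comp continuous_fst).continuousOn)
  have hF0 : ∀ p, 0 ≤ F p := fun p ↦ mul_nonneg (g.gradSq_nonneg hg _ _) (Real.exp_nonneg _)
  have hχF : ∀ k, Integrable (fun p : M × ℝ ↦ η k p.1 ^ 2 * F p) ν := fun k ↦ by
    have hwk : Continuous fun x ↦ η k x ^ 2 * Real.exp (-V x) := ((hηs k).continuous.pow 2).mul hec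
    have hη2c : HasCompactSupport (fun x ↦ η k x ^ 2) := by
      rw [show (fun x ↦ η k x ^ 2) = fun x ↦ η k x * η k x from funext fun x ↦ sq (η k x)]
      exact (hηc k).mul_right
    have hwkc : HasCompactSupport fun x ↦ η k x ^ 2 * Real.exp (-V x) := hη2c.mul_right
    have h := integrable_strip_mul_of_hasCompactSupport μ (hgradc.mono (prod_mono le_rfl hTO))
      hwk hwkc
    exact h.congr (Eventually.of_forall fun p ↦ by simp only [hFdef]; ring)
  have hlim2 : ∀ x, Tendsto (fun k ↦ η k x ^ 2) atTop (𝓝 1) := fun x ↦ by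
    simpa using (tendsto_cutoff_of_eventually_eq hη1 x).pow 2
  have hFint : Integrable F ν :=
    CarrilloNi2009_shrinkerLSI.integrable_of_forall_integral_cutoff_mul_le hFm hF0
      (fun k p ↦ sq_nonneg (η k p.1)) hχF (fun p ↦ hlim2 p.1) (K := A + 4 * (|C₀| * B)) hKbound
  -- Step 6: `∫ η_k² F → ∫ F` (dominated convergence) and the bound
  have hI_tendsto : Tendsto (fun k ↦ ∫ p, η k p.1 ^ 2 * F p ∂ν) atTop (𝓝 (∫ p, F p ∂ν)) := by
    refine tendsto_integral_of_dominated_convergence F (fun k ↦ (hχF k).aestronglyMeasurable) hFint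
      (fun k ↦ Eventually.of_forall fun p ↦ ?_) (Eventually.of_forall fun p ↦ ?_)
    · rw [Real.norm_eq_abs, abs_of_nonneg (mul_nonneg (sq_nonneg _) (hF0 p))]
      exact mul_le_of_le_one_left (hF0 p) (hsq1 k p.1)
    · simpa using (hlim2 p.1).mul_const (F p)
  have hb_tendsto : Tendsto (fun k : ℕ ↦ A + 4 * (C₀ / ((k : ℝ) + 1) ^ 2 * B)) atTop (𝓝 (A + 4 * 0)) :=
    tendsto_const_nhds.add (hr_tendsto.const_mul 4)
  have hfinal : ∫ p, F p ∂ν ≤ A + 4 * 0 := le_of_tendsto_of_tendsto' hI_tendsto hb_tendsto hI_le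
  refine ⟨hFint, ?_⟩
  have hgoal : ∫ p, F p ∂ν ≤ A := by linarith [hfinal]
  simpa only [hFdef] using hgoal

end Energy

end Summit.SmoothPoincare4.SmoothPoincare4.Theorems.BakryEmeryComplete

end
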